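import Summits.NavierStokesRegularity.NavierStokesRegularity.Theorems.FilamentSkeletonRssCoreGluingClassicalOfProfile
import Literature.Analysis.FluidPDE.PineauVicolRSSProofs
import Literature.Analysis.FluidPDE.AncientSimilarityVariables
import HarnessLib

/-!
# `SpiralScalingLiouville` (stmt-NavierStokesRegularity-8216), line `registered` (birth skeleton,
# lead's reshape): stub `stub_pvClassOfProfile` — Pineau–Vicol's class from a profile

The dictionary step profile ⇒ solution. A smooth divergence-free solution `(V, Q)` of Pineau–Vicol's
rotated self-similar profile system (arXiv:2607.09619, (1.8a), `J = rotGen = e₃ × ·`)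

  `α(JV − DV[Jy]) + ½V + ½DV[y] − ΔV + DV[V] + ∇Q = 0`, `∇·V = 0`,

with the Type-I profile decay `‖V(y)‖ ≤ K/(‖y‖ + 1)` ((1.9)) generates, through the rotated
self-similar ansatz (1.7) `u = pvAnsatz α V`, `u(t,x) = (−t)^{−1/2} R(αs) V(R(−αs) x/√(−t))`,
`s = −log(−t)`, a classical Navier–Stokes solution (`ν = 1`, `f = 0`) on the time set `[−1, 0)` with
the smooth pressure `p(t,x) = (−t)⁻¹ Q(R(−αs) x/√(−t))`, obeying the Type-I bound (1.10)
`‖u(t,x)‖ ≤ K/(‖x‖ + √(−t))` with the SAME constant `K` (Remark 1.2).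

Proof: everything is in the tree. The rotating profile `(s, y) ↦ R(αs) V(R(−αs) y)` with pressure
profile `(s, y) ↦ Q(R(−αs) y)` solves the backward Leray system on `ℝ × ℝ³`
(`classicalOfProfile_isBackwardLeraySolutionOn`), hence its physical field — definitionally the ansatz
field — is a classical solution on `(−∞, 0)` (`isClassicalNSSolutionOn_Iio_ofLerayOrbit_iff`); restrict
the time set to `[−1, 0)` (`IsClassicalNSSolutionOn.mono`, `uniqueDiffOn_Ico`). The Type-I bound is
`PineauVicol2026.typeI_of_norm_profile_le`.

## References

* B. Pineau, V. Vicol, arXiv:2607.09619 (2026), (1.7)–(1.10) and Remark 1.2, pp. 3–4. [PineauVicol2026]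
-/

noncomputable section

-- the summit and its single problem share the name (D-0017 nested layout)
set_option linter.dupNamespace false

open Set Function
open scoped ContDiff Laplacian
open Literature.Analysis.FluidPDE

namespace Summit.NavierStokesRegularity.NavierStokesRegularity.Theorems.SpiralScalingLiouville.Birth

/-- Local notation for physical space `ℝ³`. -/
local notation "E3" => EuclideanSpace ℝ (Fin 3)

/-- **Stub 2c — Pineau–Vicol's class from a profile.** A smooth divergence-free solution `(V, Q)` of
the profile system (1.8a) `α(JV − DV[Jy]) + ½V + ½DV[y] − ΔV + DV[V] + ∇Q = 0` with
`‖V(y)‖ ≤ K/(‖y‖ + 1)` generates through the ansatz (1.7) `u = pvAnsatz α V` a classical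
Navier–Stokes solution (`ν = 1`, `f = 0`) on the time set `[−1, 0)`, with the pressure
`p(t,x) = (−t)⁻¹ Q(R(−αs) x/√(−t))`, `s = −log(−t)` (tree: `classicalOfProfile_isBackwardLeraySolutionOn`,
`isClassicalNSSolutionOn_Iio_ofLerayOrbit_iff`, restriction `IsClassicalNSSolutionOn.mono`), obeying the
Type-I bound (1.10) `‖u(t,x)‖ ≤ K/(‖x‖ + √(−t))` with the same constant (Remark 1.2; tree:
`PineauVicol2026.typeI_of_norm_profile_le`).
[cite: PineauVicol2026, (1.7)–(1.8) and Remark 1.2 (arXiv:2607.09619 pp. 3–4)] -/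
theorem stub_pvClassOfProfile :
    ∀ (α : ℝ) (V : E3 → E3) (Q : E3 → ℝ), ContDiff ℝ ∞ V → ContDiff ℝ ∞ Q → VectorCalculus.IsDivFree V →
      (∀ y, α • (rotGen (V y) - fderiv ℝ V y (rotGen y)) + (1 / 2 : ℝ) • V y + (1 / 2 : ℝ) • fderiv ℝ V y y
          - (Δ V) y + fderiv ℝ V y (V y) + gradient Q y = 0) →
      ∀ K : ℝ, (∀ y, ‖V y‖ ≤ K / (‖y‖ + 1)) →
      ∃ p : ℝ → E3 → ℝ, IsClassicalNSSolutionOn (Ico (-1) 0) 1 0 (pvAnsatz α (fun y _ => V y)) p ∧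
        ∀ t ∈ Ico (-1 : ℝ) 0, ∀ x : E3, ‖pvAnsatz α (fun y _ => V y) t x‖ ≤ K / (‖x‖ + Real.sqrt (-t)) := by
  intro α V Q hV hQ hdiv heq K hK
  -- the rotating profile solves the backward Leray system on `ℝ × ℝ³`
  have hL := Theorems.classicalOfProfile_isBackwardLeraySolutionOn (α := α) hV hQ hdiv heq
  -- hence its physical field is a classical Navier–Stokes solution on the whole past `(-∞, 0)`
  have hNS := isClassicalNSSolutionOn_Iio_ofLerayOrbit_iff.2 hL
  refine ⟨ofLerayOrbitPressure fun (s : ℝ) (y : E3) => Q (rotZ (-(α * s)) y), ?_, ?_⟩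
  · -- the ansatz field IS the physical field of the rotating profile; restrict to `[-1, 0)`
    have e : pvAnsatz α (fun y _ => V y) =
        ofLerayOrbit (fun (s : ℝ) (y : E3) => rotZ (α * s) (V (rotZ (-(α * s)) y))) := by
      funext t x
      rfl
    rw [e]
    exact hNS.mono Ico_subset_Iio_self (uniqueDiffOn_Ico _ _)
  · -- the Type-I bound (1.10) with the same constant (Remark 1.2)
    exact PineauVicol2026.typeI_of_norm_profile_le (U := fun y _ => V y) fun y _ _ => by
      rw [add_comm (1 : ℝ)]
      exact hK y

end Summit.NavierStokesRegularity.NavierStokesRegularity.Theorems.SpiralScalingLiouville.Birth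

end
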